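import Literature.Analysis.FluidPDE.TorusNSLinearisationRemainderH1
import HarnessLib

/-!
# Continuity in `H¹` of the linearisation `(u, w) ↦ DG(u)[w]` of the projected Navier–Stokes vector
# field on Gevrey balls of `T³`

Analysis/FluidPDE proof file (theorems only; no definitions, no named facts), sequel of
`TorusNSLinearisationRemainderH1.lean`.  For the linearisation `DG(u)[w] = P(νΔw − (u·∇)w − (w·∇)u)`
(`P v = v − ∇Δ⁻¹div v`) of the projected vector field `G(u) = νΔu − P((u·∇)u)` we prove
(`Torus.exists_h1_linearisation_sub_le`, `card d = 3`): for `u` in a Gevrey ball, `w'` Gevrey of level `D`,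
and differences `r = w − w'`, `η = u − u'` of zero mean with `H³`-sums `≤ ε_w`, `≤ ε_u`,

  `‖DG(u)[w] − DG(u')[w']‖²_{H¹} ≤ K (ε_w + ε_u)`,   `K = K(ν, σ₁, C₁, σ₂, D)`,

since `DG(u)[w] − DG(u')[w'] = P(νΔr − (u·∇)r − (r·∇)u − ((w'·∇)η + (η·∇)w'))`: the first part is
`O(ε_w)` (`Torus.h1_linearisation_le`) and the second is `O(ε_u)` by the `H¹` product estimate
`Torus.h1_convect_add_convect_le_three` with the `O(√D)` sup bounds of `w'` and the sup bound of the zero-mean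
`η`.  Together with Gevrey interpolation this is the joint operator-norm continuity of the mixed derivative
`∂ₜ∂_y` of the smooth model of the NS semiflow (block N of the smooth-model construction).

## Mathlib / tree search

Tree (reused): `TorusNSLinearisationRemainderH1` (`h1_linearisation_le`, `h1_leray_sub_le_of_sub_eq`,
`sobolev_quantities_le_of_sum_le`, `sup_quantities_le_of_gevreyBound`), `TorusNSVectorFieldHolder`
(`h1_convect_add_convect_le_three`), `TorusConvectionGradNormSq` (`norm_sq_le_gradNormSq_add_of_hasZeroMean`),
`TorusGevreySobolevBounds` (`exists_sobolevBounds_of_gevreyBound`).  Searched `linearisation_sub`, `DG(u)`: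
nothing else.

## References

* P. Constantin, C. Foias, *Navier–Stokes Equations*, Univ. Chicago Press 1988, Ch. 14. [ConstantinFoiasNSE1988]
* J. C. Robinson, J. L. Rodrigo, W. Sadowski, *The Three-Dimensional Navier–Stokes Equations*, CUP 2016,
  proof of Thm 7.1 ((7.3), product estimates). [RobinsonRodrigoSadowskiCUP2016]
-/

noncomputable section

open _root_.MeasureTheory Set Filter Function UnitAddTorus
open scoped InnerProductSpace ContDiff Topology BigOperators

namespace Literature.Analysis.FluidPDE

namespace Torus

open Literature.Analysis.FunctionSpaces Literature.Analysis.FunctionSpaces.Torus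

variable {d : Type*} [Fintype d] [DecidableEq d]

/-- **Continuity in `H¹` of the linearisation `(u, w) ↦ DG(u)[w] = P(νΔw − (u·∇)w − (w·∇)u)` on Gevrey balls of
`T³`.**  On `T^d` with `card d = 3`, for `ν`, `σ₁, σ₂ > 0`, `C₁`, `D` there is `K ≥ 0` such that for smooth
`u, u', w, w'` with `∫(u − u') = ∫(w − w') = 0`, `∑_{k∈S} e^{2σ₁|k|}‖û(k)‖² ≤ C₁`, `∑_{k∈S} e^{2σ₂|k|}‖ŵ'(k)‖² ≤ D`,
`∑_{k∈S}(1 + |k|²)³‖𝓕(w − w')(k)‖² ≤ ε_w` and `∑_{k∈S}(1 + |k|²)³‖𝓕(u − u')(k)‖² ≤ ε_u` (all finite `S`):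
`∫‖DG(u)[w] − DG(u')[w']‖² + ‖∇(DG(u)[w] − DG(u')[w'])‖₂² ≤ K (ε_w + ε_u)`. [cite: ConstantinFoiasNSE1988, Ch. 14 Lemma 14.3 (14.10)] -/
theorem exists_h1_linearisation_sub_le [Nonempty d] (hd : Fintype.card d = 3) (ν σ₁ C₁ σ₂ D : ℝ) (hσ₁ : 0 < σ₁)
    (hσ₂ : 0 < σ₂) :
    ∃ K : ℝ, 0 ≤ K ∧ ∀ (u u' w w' : UnitAddTorus d → EuclideanSpace ℝ d), IsSmooth u → IsSmooth u' → IsSmooth w →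
      IsSmooth w' → HasZeroMean (fun x => u x - u' x) → HasZeroMean (fun x => w x - w' x) →
      (∀ S : Finset (d → ℤ), ∑ k ∈ S, Real.exp (2 * σ₁ * Real.sqrt (freqNormSq k)) *
        ‖mFourierCoeff (EuclideanSpace.complexify ∘ u) k‖ ^ 2 ≤ C₁) →
      (∀ S : Finset (d → ℤ), ∑ k ∈ S, Real.exp (2 * σ₂ * Real.sqrt (freqNormSq k)) *
        ‖mFourierCoeff (EuclideanSpace.complexify ∘ w') k‖ ^ 2 ≤ D) →
      ∀ εw : ℝ, (∀ S : Finset (d → ℤ), ∑ k ∈ S, (1 + freqNormSq k) ^ 3 *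
        ‖mFourierCoeff (EuclideanSpace.complexify ∘ fun x => w x - w' x) k‖ ^ 2 ≤ εw) →
      ∀ εu : ℝ, (∀ S : Finset (d → ℤ), ∑ k ∈ S, (1 + freqNormSq k) ^ 3 *
        ‖mFourierCoeff (EuclideanSpace.complexify ∘ fun x => u x - u' x) k‖ ^ 2 ≤ εu) →
      (∫ x, ‖((ν • laplacian w x - (convect u w x + convect w u x)) -
            Torus.gradient (invLaplacian (divergence fun y => ν • laplacian w y - (convect u w y + convect w u y))) x) -
          ((ν • laplacian w' x - (convect u' w' x + convect w' u' x)) -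
            Torus.gradient (invLaplacian (divergence fun y => ν • laplacian w' y - (convect u' w' y + convect w' u' y))) x)‖ ^ 2) +
        gradNormSq (fun x => ((ν • laplacian w x - (convect u w x + convect w u x)) -
            Torus.gradient (invLaplacian (divergence fun y => ν • laplacian w y - (convect u w y + convect w u y))) x) -
          ((ν • laplacian w' x - (convect u' w' x + convect w' u' x)) -
            Torus.gradient (invLaplacian (divergence fun y => ν • laplacian w' y - (convect u' w' y + convect w' u' y))) x)) ≤
        K * (εw + εu) := by
  -- constants
  obtain ⟨B, hB⟩ := exists_sobolevBounds_of_gevreyBound (d := d) hσ₁ C₁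
  obtain ⟨K₃, hK₃pos, hK₃⟩ := norm_sq_le_gradNormSq_add_of_hasZeroMean hd
  set Z₀ : ℝ := ∑' k : d → ℤ, Real.exp (-(σ₂ * Real.sqrt (freqNormSq k))) with hZ₀
  set Z₁ : ℝ := ∑' k : d → ℤ, (1 + freqNormSq k) * Real.exp (-(σ₂ * Real.sqrt (freqNormSq k))) with hZ₁
  set KA : ℝ := 2 * ν ^ 2 * ((4 * Real.pi ^ 2) ^ 2 + (4 * Real.pi ^ 2) ^ 3) +
    2 * (18 * B ^ 2 + (6 * B ^ 2 + 72 * B ^ 2) * (4 * Real.pi ^ 2) + 12 * B ^ 2 * (4 * Real.pi ^ 2) ^ 2 +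
      12 * K₃ * (4 * Real.pi ^ 2 + (4 * Real.pi ^ 2) ^ 2) * B) with hKA
  set KB : ℝ := 18 * (4 * Real.pi ^ 2 * D * Z₁ ^ 2) + (6 * (D * Z₀ ^ 2) + 72 * (4 * Real.pi ^ 2 * D * Z₁ ^ 2)) * (4 * Real.pi ^ 2) +
    12 * (D * Z₀ ^ 2) * (4 * Real.pi ^ 2) ^ 2 + 12 * (K₃ * (4 * Real.pi ^ 2 + (4 * Real.pi ^ 2) ^ 2)) * (16 * Real.pi ^ 4 * D * Z₁ ^ 2)
    with hKB
  refine ⟨max (2 * KA) 0 + max (2 * KB) 0, by positivity,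
    fun u u' w w' hu hu' hw hw' hηz hrz hGu hGw' εw hεw εu hεu => ?_⟩
  obtain ⟨hM, hΛ, -, hY, -, -⟩ := hB u hu hGu
  have hεw0 : 0 ≤ εw := nonneg_of_sum_le hεw
  have hεu0 : 0 ≤ εu := nonneg_of_sum_le hεu
  have hD0 : 0 ≤ D := gevreyBound_nonneg hGw'
  have hsqD : Real.sqrt D ^ 2 = D := Real.sq_sqrt hD0
  have hr : IsSmooth (fun x => w x - w' x) := hw.sub hw'
  have hη : IsSmooth (fun x => u x - u' x) := hu.sub hu'
  -- ### the part `νΔr − (u·∇)r − (r·∇)u`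
  have hlin := h1_linearisation_le hd (ν := ν) hu hM hΛ hY hK₃ hK₃pos.le hr hrz hεw
  -- ### the part `(w'·∇)η + (η·∇)w'`
  obtain ⟨hw'0, hw'1, -, hw'Δ⟩ := sup_quantities_le_of_gevreyBound hσ₂ hw' hGw'
  rw [← hZ₀] at hw'0
  rw [← hZ₁] at hw'1 hw'Δ
  obtain ⟨e0, e1, e2, -⟩ := sobolev_quantities_le_of_sum_le hη hεu
  set M₀ : ℝ := Real.sqrt (K₃ * (gradNormSq (fun x => u x - u' x) + ∫ y, ‖laplacian (fun x => u x - u' x) y‖ ^ 2))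
    with hM₀def
  have hM₀ : ∀ x, ‖u x - u' x‖ ≤ M₀ := fun x => Real.le_sqrt_of_sq_le (hK₃ _ hη hηz x)
  have hM₀sq : M₀ ^ 2 ≤ K₃ * (4 * Real.pi ^ 2 + (4 * Real.pi ^ 2) ^ 2) * εu := by
    rw [hM₀def, Real.sq_sqrt (mul_nonneg hK₃pos.le (add_nonneg (gradNormSq_nonneg _) (integral_nonneg fun _ => sq_nonneg _)))]
    nlinarith [mul_le_mul_of_nonneg_left (add_le_add e1 e2) hK₃pos.le]
  have hprod := h1_convect_add_convect_le_three hd hw' hw' hη hw'0 hw'1 hw'1 hM₀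
  have hm0 : (Real.sqrt D * Z₀) ^ 2 = D * Z₀ ^ 2 := by rw [mul_pow, hsqD]
  have hm1 : (2 * Real.pi * Real.sqrt D * Z₁) ^ 2 = 4 * Real.pi ^ 2 * D * Z₁ ^ 2 := by ring_nf; rw [hsqD]; ring
  have hm2 : (4 * Real.pi ^ 2 * Real.sqrt D * Z₁) ^ 2 = 16 * Real.pi ^ 4 * D * Z₁ ^ 2 := by ring_nf; rw [hsqD]; ring
  rw [hm0, hm1] at hprod
  rw [hm2] at hw'Δ
  have hBterm : (∫ x, ‖convect w' (fun x => u x - u' x) x + convect (fun x => u x - u' x) w' x‖ ^ 2) +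
      gradNormSq (fun x => convect w' (fun x => u x - u' x) x + convect (fun x => u x - u' x) w' x) ≤ KB * εu := by
    have f1 : 18 * (4 * Real.pi ^ 2 * D * Z₁ ^ 2) * (∫ x, ‖u x - u' x‖ ^ 2) ≤ 18 * (4 * Real.pi ^ 2 * D * Z₁ ^ 2) * εu :=
      mul_le_mul_of_nonneg_left e0 (by positivity)
    have f2 : (6 * (D * Z₀ ^ 2) + 72 * (4 * Real.pi ^ 2 * D * Z₁ ^ 2)) * gradNormSq (fun x => u x - u' x) ≤
        (6 * (D * Z₀ ^ 2) + 72 * (4 * Real.pi ^ 2 * D * Z₁ ^ 2)) * (4 * Real.pi ^ 2 * εu) :=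
      mul_le_mul_of_nonneg_left e1 (by positivity)
    have f3 : 12 * (D * Z₀ ^ 2) * (∫ x, ‖laplacian (fun x => u x - u' x) x‖ ^ 2) ≤
        12 * (D * Z₀ ^ 2) * ((4 * Real.pi ^ 2) ^ 2 * εu) := mul_le_mul_of_nonneg_left e2 (by positivity)
    have f4 : 12 * M₀ ^ 2 * (∫ x, ‖laplacian w' x‖ ^ 2) ≤
        12 * (K₃ * (4 * Real.pi ^ 2 + (4 * Real.pi ^ 2) ^ 2) * εu) * (16 * Real.pi ^ 4 * D * Z₁ ^ 2) :=
      mul_le_mul (mul_le_mul_of_nonneg_left hM₀sq (by norm_num)) hw'Δ (integral_nonneg fun _ => sq_nonneg _)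
        (by positivity)
    have hexp : KB * εu = 18 * (4 * Real.pi ^ 2 * D * Z₁ ^ 2) * εu +
        (6 * (D * Z₀ ^ 2) + 72 * (4 * Real.pi ^ 2 * D * Z₁ ^ 2)) * (4 * Real.pi ^ 2 * εu) +
        12 * (D * Z₀ ^ 2) * ((4 * Real.pi ^ 2) ^ 2 * εu) +
        12 * (K₃ * (4 * Real.pi ^ 2 + (4 * Real.pi ^ 2) ^ 2) * εu) * (16 * Real.pi ^ 4 * D * Z₁ ^ 2) := by
      rw [hKB]; ring
    linarith [hprod, f1, f2, f3, f4, hexp]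
  -- ### algebra
  have hYs : IsSmooth (fun y => ν • laplacian w y - (convect u w y + convect w u y)) :=
    (hw.laplacian.smul ν).sub ((hu.convect hw).add (hw.convect hu))
  have hY's : IsSmooth (fun y => ν • laplacian w' y - (convect u' w' y + convect w' u' y)) :=
    (hw'.laplacian.smul ν).sub ((hu'.convect hw').add (hw'.convect hu'))
  have hAs : IsSmooth (fun x => ν • laplacian (fun z => w z - w' z) x -
      (convect u (fun z => w z - w' z) x + convect (fun z => w z - w' z) u x)) :=
    (hr.laplacian.smul ν).sub ((hu.convect hr).add (hr.convect hu))
  have hBs : IsSmooth (fun x => convect w' (fun x => u x - u' x) x + convect (fun x => u x - u' x) w' x) :=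
    (hw'.convect hη).add (hη.convect hw')
  have hdiff : ∀ x, (ν • laplacian w x - (convect u w x + convect w u x)) -
      (ν • laplacian w' x - (convect u' w' x + convect w' u' x)) =
      (ν • laplacian (fun z => w z - w' z) x - (convect u (fun z => w z - w' z) x + convect (fun z => w z - w' z) u x)) -
        (convect w' (fun x => u x - u' x) x + convect (fun x => u x - u' x) w' x) := by
    intro x
    have hL : laplacian (fun z => w z - w' z) x = laplacian w x - laplacian w' x := by
      rw [show (fun z => w z - w' z) = w - w' from rfl, laplacian_sub hw hw', Pi.sub_apply]
    have hC1 : convect u (fun z => w z - w' z) x = convect u w x - convect u w' x := by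
      rw [show (fun z => w z - w' z) = w - w' from rfl]
      simp only [convect, Torus.fderiv_sub (hw.isContDiff (by simp)) (hw'.isContDiff (by simp)) x, sub_apply]
    have hC2 : convect (fun z => w z - w' z) u x = convect w u x - convect w' u x := by
      simp only [convect, map_sub]
    have hC3 : convect w' (fun x => u x - u' x) x = convect w' u x - convect w' u' x := by
      rw [show (fun z => u z - u' z) = u - u' from rfl]
      simp only [convect, Torus.fderiv_sub (hu.isContDiff (by simp)) (hu'.isContDiff (by simp)) x, sub_apply]
    have hC4 : convect (fun x => u x - u' x) w' x = convect u w' x - convect u' w' x := by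
      simp only [convect, map_sub]
    rw [hL, hC1, hC2, hC3, hC4, smul_sub]
    abel
  -- ### assembly
  refine (h1_leray_sub_le_of_sub_eq hYs hY's hAs hBs hdiff hlin hBterm).trans ?_
  have hKA' : (2 * ν ^ 2 * ((4 * Real.pi ^ 2) ^ 2 + (4 * Real.pi ^ 2) ^ 3) +
      2 * (18 * B ^ 2 + (6 * B ^ 2 + 72 * B ^ 2) * (4 * Real.pi ^ 2) + 12 * B ^ 2 * (4 * Real.pi ^ 2) ^ 2 +
        12 * K₃ * (4 * Real.pi ^ 2 + (4 * Real.pi ^ 2) ^ 2) * B)) * εw ≤ max (2 * KA) 0 / 2 * εw := by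
    refine mul_le_mul_of_nonneg_right ?_ hεw0
    rw [← hKA]
    have := le_max_left (2 * KA) 0
    linarith
  have hKB' : KB * εu ≤ max (2 * KB) 0 / 2 * εu := by
    refine mul_le_mul_of_nonneg_right ?_ hεu0
    have := le_max_left (2 * KB) 0
    linarith
  have hexp : (max (2 * KA) 0 + max (2 * KB) 0) * (εw + εu) =
      2 * (max (2 * KA) 0 / 2 * εw) + max (2 * KA) 0 * εu + max (2 * KB) 0 * εw + 2 * (max (2 * KB) 0 / 2 * εu) := by
    ring
  have h1 : 0 ≤ max (2 * KA) 0 * εu := by positivity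
  have h2 : 0 ≤ max (2 * KB) 0 * εw := by positivity
  linarith

end Torus

end Literature.Analysis.FluidPDE

end
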